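import Summits.BirchSwinnertonDyer.BirchSwinnertonDyer.Theorems.SchneiderFreeAdditiveX3KrizLiLocusLValueFree
import Summits.BirchSwinnertonDyer.BirchSwinnertonDyer.Theorems.PrintCFramBottomClassIndexLawFiveLeOffLocusDictionary
import Literature.NumberTheory.EllipticCurves.KrizLi2019.ThreeIsogenyHeegnerFieldSupply
import Literature.NumberTheory.EllipticCurves.HeegnerHypothesisKroneckerProofs
import HarnessLib

/-!
# Route `SchneiderFreeAdditiveX3` (K1 door): at `p = 3` the Heegner field of the Kriz–Li road is SUPPLIED by Kriz–Li's Theorem 9.4 —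
# the rung leaf's body `MissingLowerBoundAt W 3` holds CLASS-WIDE on the explicit Kriz–Li sub-locus of the door (conditions on `W` and
# its `3`-isogeny character `ψ` alone), from PUBLISHED theorems only: no branch main conjecture, no preprint, no per-pair `L`-value

Cell `bsd-schneider-ideate`, seat `bsd-schneider-door-c5` (prover, generation 36; leaf load-bearing, `--supports` 19177 as helper).
PARTITION: board row B6 ∩ X3 ∩ sst-twist, `r = 1`, `p = 3` (6 794 of the door's 7 101 census pairs), the KRIZ–LI SUB-LOCUS: pairs `(W, 3)`
whose `3`-isogeny character `ψ` (quadratic, `W[3]^{ss} ≅ 𝔽₃(ψ) ⊕ 𝔽₃(ψ⁻¹ω)`) satisfies Kriz–Li's Thm. 7.1 (1)–(3) and Thm. 9.4 (3)–(6) — a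
DECIDABLE arithmetic condition on the isogeny class (door-c2 g7's census, kit j260994: (1)–(3) hold at 24 of the 6 794 pairs at `p = 3`;
(4)–(6) not yet censused) — of `Rank1Residual.partition`; types-the-object-of nothing new; closes none of B6's cells; BSD NOT advanced;
«closes rung: none».  bears_on: K1-door (rung K1 leaf `SchneiderFree.AdditiveX3RankOneLower`, its body at these pairs WITHOUT r2/r3).

WHY.  On the Kriz–Li locus the leaf's body needs, beyond `PrintedFacts` and Kriz–Li 2019 Thm. 1.20, only a Heegner field `K` with odd
`d_K` and Kriz–Li's Bernoulli hypothesis (4) (this seat, generation 36, `KrizLiLocusLValueFree`).  At `p = 3` the EXISTENCE of such a field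
is a published theorem: Kriz–Li's **Theorem 9.4** (Nakagawa–Horie + Taya: a positive proportion of imaginary quadratic `K` have `d_K` odd,
the Heegner hypothesis for `3N`, and `h₃(d₀ d_K) = 1`), typed as `KrizLi2019.thm94_exists_heegnerField_h3_of_threeIsogeny` (existence
form), and their **§8** (the class number formula (35) with Lemma 8.2 / Cor. 8.3: at `p = 3` all characters are quadratic and
`3 ∤ h(K_{ψ₀ε_K})·h(K_{ψ₀⁻¹ω})` gives (4)), typed as `KrizLi2019.cor83_bernoulli_unit_three_of_h3` — both in
`Literature/…/KrizLi2019/ThreeIsogenyHeegnerFieldSupply.lean` (this seat, filed with this consumer).  The Kronecker character `ε_K` exists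
for every quadratic field (`PrintCFram.OffLocusDictionary.exists_isKroneckerCharacterOf`, cell `bsd-print-cfram`); `(f, d_K) = 1` and
`3 ∤ d_K` because every prime of `3N` splits in `K` (`SatisfiesHeegnerHypothesis.not_dvd_discr`).

WHAT.  §1 **`missingLowerBoundAt_three_of_printedFacts_of_krizLi_of_thm94`**: for `W/ℚ` globally minimal on the door at `p = 3`
(`r_an(W) = 1`, `ClassX3 W 3`, semistable twist) with a quadratic primitive `ψ` of conductor `f` supported on `3N_W` and the Teichmüller `ω`
presenting `W[3]^{ss}` in trace form, such that: (1) `ψ(3) ≠ 1`, `(ψ⁻¹ω)(3) ≠ 1`; (2) `W` has NO split multiplicative prime; (3) at every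
additive `ℓ ≠ 3`, `ψ(ℓ) ≠ 1` and `(ψ⁻¹ω)(ℓ) ≠ 1`; Thm. 9.4's (3) `ψ(ℓ) = 1` at the (non-split) multiplicative `ℓ ≠ 3`, (4) `ψ(ℓ) ∈ {−1, 0}` at
the additive `ℓ ≡ 1 (mod 3)`, (5) `ψ(ℓ) = 0` at the additive `ℓ ≡ 2 (mod 3)`, and (6) `h₃(−3f) = 1` if `ψ` is even, `h₃(−f) = 1` if `ψ` is odd
(`d = ψ(−1)·f`): **`Typed.MissingLowerBoundAt W 3`** — the lower half of BSD₃ at `W`.  §2 the same as an implication over the door at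
`p = 3` with an existential over the character data only (`additiveX3RankOneLower_three_onKrizLiSubLocus`).

HONEST FRAMING: CONDITIONAL on the displayed named facts — `PrintedFacts` (thirteen published theorems, item 19184), Kriz–Li 2019 Thm. 1.20,
Thm. 9.4 (first assertion) and §8 (Lemma 8.2 / Cor. 8.3 with (35)) — all PUBLISHED and refereed; no preprint, no branch main conjecture, no
Schneider-type hypothesis.  It is the first statement on the K1 door that is CLASS-WIDE (all curves of an explicit sub-locus, not a census)
and rests on published theorems only; the sub-locus is THIN (Kriz–Li's (2) «no split multiplicative prime» fails at ≈ 93 % of the door,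
door-c2 g7) and the route's cruxes r2/r3 remain exactly as open as before; nothing is closed; BSD is proved for no curve.
References: Kriz–Li, Forum Math. Sigma 7 (2019) e15, Thm. 1.20, Thm. 7.1, §8, Thm. 9.4, Rem. 9.6 [KrizLi2019]; Nakagawa–Horie, Proc. AMS 104
(1988) Thm. 1; Taya, Proc. AMS 128 (2000); Gross–Zagier 1986 I.(6.3) [GrossZagier1986]; Jetchev–Skinner–Wan 2017 §7.4.1
[JetchevSkinnerWan2017]; this route p470696 (door-c2 g7), this seat F25b (`KrizLiLocusLValueFree`).
-/

set_option autoImplicit false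
-- `Summit.<P>.<Sub>` repeats `BirchSwinnertonDyer` by the tree's layout convention (D-0017)
set_option linter.dupNamespace false

noncomputable section

open scoped Classical

open Field NumberField IsDedekindDomain WeierstrassCurve
open Literature.NumberTheory.EllipticCurves Literature.NumberTheory.EllipticCurves.ModularForms
  Literature.NumberTheory.EllipticCurves.Rank1Residual Literature.NumberTheory.EllipticCurves.Rank1Residual.Typed
  Literature.NumberTheory.EllipticCurves.KrizLi2019
  Summit.BirchSwinnertonDyer.Rank1Residual Summit.BirchSwinnertonDyer.BirchSwinnertonDyer.Theorems.SchneiderFree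
  Summit.BirchSwinnertonDyer.BirchSwinnertonDyer.Theses.SchneiderFreeAdditiveX3

namespace Summit.BirchSwinnertonDyer.BirchSwinnertonDyer.Theorems.SchneiderFreeAdditiveX3.KrizLiLocusSupplyThree

/-! ### §1 The leaf's body at `p = 3` from the character data alone -/

/-- **The lower half of BSD₃ at a curve of the K1 door with Kriz–Li character data, from PUBLISHED theorems only.**  For `W/ℚ` globally
minimal on the door at `p = 3` (`r_an(W) = 1`, `ClassX3 W 3`, semistable twist at `3`), a primitive quadratic `ψ` of conductor `f` supported on
`3N_W` and the Teichmüller `ω` with `W[3]^{ss} ≅ 𝔽₃(ψ) ⊕ 𝔽₃(ψ⁻¹ω)` (trace form), satisfying Kriz–Li's Thm. 7.1 (1) `ψ(3) ≠ 1`, `(ψ⁻¹ω)(3) ≠ 1`,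
(2) no split multiplicative prime, (3) `ψ(ℓ) ≠ 1`, `(ψ⁻¹ω)(ℓ) ≠ 1` at the additive `ℓ ≠ 3`, and Thm. 9.4 (3) `ψ(ℓ) = 1` at the multiplicative
`ℓ ≠ 3`, (4)/(5) at the additive `ℓ ≡ 1, 2 (mod 3)`, (6) `h₃(−3f) = 1` (`ψ` even) / `h₃(−f) = 1` (`ψ` odd): `MissingLowerBoundAt W 3`.  PROOF:
Thm. 9.4 (`h94`; its (2) is vacuous by Thm. 7.1 (2)) supplies an imaginary quadratic `K` with `d_K` odd, Heegner for `3N_W` (hence for `N_W`,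
with `(f, d_K) = 1` and `3 ∤ d_K`) and `h₃(d₀ d_K) = 1`; its Kronecker character `ε_K` exists; §8 (`h83`) turns `h₃(d₀ d_K) = 1` and (6) into
Thm. 7.1 (4); generation 36's `KrizLiLocusLValueFree.missingLowerBoundAt_of_printedFacts_of_thm120_of_heegnerField` concludes.  CONDITIONAL on
`hF`, `hKL`, `h94`, `h83` (all published). [cite: KrizLi2019, Thm. 9.4 (first assertion), Rem. 9.6, §8 (35) / Lemma 8.2 / Cor. 8.3, Thm. 1.20]
[cite: GrossZagier1986, Thm. I.(6.3) and V.§2] [cite: JetchevSkinnerWan2017, §7.4.1 (arXiv:1512.06894 p. 30)] -/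
theorem missingLowerBoundAt_three_of_printedFacts_of_krizLi_of_thm94 (hF : PrintedFacts)
    (hKL : KrizLi2019.thm120_padicLogHeegner_unit_of_bernoulli)
    (h94 : KrizLi2019.thm94_exists_heegnerField_h3_of_threeIsogeny) (h83 : KrizLi2019.cor83_bernoulli_unit_three_of_h3)
    (W : WeierstrassCurve ℚ) [W.IsElliptic] [W.IsGloballyMinimal]
    (hr : W.analyticRank = 1) (hX : ClassX3 W 3) (hS : Additive.SubSemistableTwist W 3)
    -- Kriz–Li's character data at `(W, 3)`: `ψ` quadratic primitive of conductor `f` supported on `3N`, `ω` Teichmüller, trace form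
    (f : ℕ) [NeZero f] (ψ : DirichletCharacter ℚ_[3] f) (ω : DirichletCharacter ℚ_[3] 3)
    (hψ : ψ.IsPrimitive) (hq : ψ ^ 2 = 1) (hω : KrizLi2019.IsTeichmullerCharacter ω)
    (hfN : ∀ q : ℕ, q.Prime → q ∣ f → q ∣ 3 * W.conductorNorm ℤ)
    (hss : ∀ ℓ : ℕ, ℓ.Prime → ¬ (ℓ ∣ 3 * W.conductorNorm ℤ) →
      ‖((W.LFunction ℓ : ℤ) : ℚ_[3]) - (ψ (ℓ : ZMod f) + ψ⁻¹ (ℓ : ZMod f) * ω (ℓ : ZMod 3))‖ < 1)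
    -- Kriz–Li Thm. 7.1 (1), (2), (3)
    (h1 : ψ ((3 : ℕ) : ZMod f) ≠ 1) (h1' : KrizLi2019.primVal (KrizLi2019.invMulOmega ψ ω) 3 ≠ 1)
    (h2 : ∀ ℓ : ℕ, (hℓ : ℓ.Prime) → ¬ (haveI := Fact.mk hℓ; W.HasSplitMultiplicativeReductionAtPrime ℓ))
    (h3 : ∀ ℓ : ℕ, (hℓ : ℓ.Prime) → ℓ ≠ 3 →
      (haveI := Fact.mk hℓ; ¬ W.HasGoodReductionAtPrime ℓ ∧ ¬ W.HasMultiplicativeReductionAtPrime ℓ) →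
      ψ (ℓ : ZMod f) ≠ 1 ∧ KrizLi2019.primVal (KrizLi2019.invMulOmega ψ ω) ℓ ≠ 1)
    -- Kriz–Li Thm. 9.4 (3), (4), (5), (6)
    (h94c : ∀ ℓ : ℕ, (hℓ : ℓ.Prime) → ℓ ≠ 3 →
      (haveI := Fact.mk hℓ; W.HasMultiplicativeReductionAtPrime ℓ ∧ ¬ W.HasSplitMultiplicativeReductionAtPrime ℓ) →
      ψ (ℓ : ZMod f) = 1)
    (h94d : ∀ ℓ : ℕ, (hℓ : ℓ.Prime) → ℓ % 3 = 1 →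
      (haveI := Fact.mk hℓ; ¬ W.HasGoodReductionAtPrime ℓ ∧ ¬ W.HasMultiplicativeReductionAtPrime ℓ) →
      ψ (ℓ : ZMod f) = -1 ∨ ψ (ℓ : ZMod f) = 0)
    (h94e : ∀ ℓ : ℕ, (hℓ : ℓ.Prime) → ℓ % 3 = 2 →
      (haveI := Fact.mk hℓ; ¬ W.HasGoodReductionAtPrime ℓ ∧ ¬ W.HasMultiplicativeReductionAtPrime ℓ) →
      ψ (ℓ : ZMod f) = 0)
    (h6 : (ψ.Even → ThreeClassNumberTrivial (-3 * (f : ℤ))) ∧ (ψ.Odd → ThreeClassNumberTrivial (-(f : ℤ)))) :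
    MissingLowerBoundAt W 3 := by
  -- Theorem 9.4: a Heegner field `K` for `3N_W` with odd `d_K` and `h₃(d₀ d_K) = 1` (its hypothesis (2) is vacuous by Thm. 7.1 (2))
  obtain ⟨K, _, _, hK, hodd, hH3, h3e, h3o⟩ :=
    h94 W f ψ ω hψ hq hω hss h1 h1' (fun ℓ hℓ _ hsp ↦ absurd hsp (h2 ℓ hℓ)) h94c h94d h94e
  have hHe : SatisfiesHeegnerHypothesis (W.conductorNorm ℤ) K := hH3.of_dvd (dvd_mul_left _ _)
  -- every prime of `3N_W` splits in `K`: `(f, d_K) = 1` and `3 ∤ d_K`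
  have hcop : Nat.Coprime f (NumberField.discr K).natAbs :=
    Nat.coprime_of_dvd fun q hq hqf hqd ↦
      Literature.SatisfiesHeegnerHypothesis.not_dvd_discr hK.1 hH3 hq (hfN q hq hqf) (Int.natCast_dvd.mpr hqd)
  have h3d : ¬ ((3 : ℤ) ∣ NumberField.discr K) := by
    simpa using Literature.SatisfiesHeegnerHypothesis.not_dvd_discr hK.1 hH3 Nat.prime_three (dvd_mul_right 3 _)
  -- the Kronecker character of `K`, and §8: `h₃(d₀ d_K) = 1` with (6) gives Thm. 7.1 (4)
  haveI : NeZero (NumberField.discr K).natAbs := ⟨Int.natAbs_ne_zero.mpr (NumberField.discr_ne_zero K)⟩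
  obtain ⟨εK, hεK⟩ := PrintCFram.OffLocusDictionary.exists_isKroneckerCharacterOf (p := 3) hK.1
  have h4 := h83 f ψ ω hψ hq hω h1 h1' K hK hcop h3d εK hεK (fun he ↦ ⟨h3e he, h6.1 he⟩) (fun ho ↦ ⟨h6.2 ho, h3o ho⟩)
  -- the `L`-value-free Kriz–Li road (generation 36, `KrizLiLocusLValueFree`)
  exact KrizLiLocusLValueFree.missingLowerBoundAt_of_printedFacts_of_thm120_of_heegnerField hF hKL W 3 hr (by norm_num) hX hS
    f ψ ω hψ hω hss h1 h1' h2 h3 K hK hodd hHe εK hεK h4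

/-! ### §2 Class level: the leaf on the Kriz–Li sub-locus of the door at `p = 3`, from published facts -/

/-- **The K1 rung leaf ON THE KRIZ–LI SUB-LOCUS AT `p = 3`, CLASS-WIDE, from `PrintedFacts` and Kriz–Li 2019 (Thm. 1.20, Thm. 9.4, §8)
only.**  Every curve `W` of the door at `p = 3` (`r_an = 1`, `ClassX3 W 3`, semistable twist) whose `3`-isogeny character admits Kriz–Li
character data `(f, ψ, ω)` — `ψ` quadratic primitive supported on `3N_W`, trace form, Thm. 7.1 (1)–(3), Thm. 9.4 (3)–(6) — satisfies the
leaf's body `MissingLowerBoundAt W 3`.  The existential is over CHARACTER DATA ONLY (no field, no point, no parametrisation datum, no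
`L`-value): a decidable condition on the isogeny class.  Compare door-c2's `additiveX3RankOneLower_onKrizLiLocus_of_printedFacts_of_pt_of_thm120`
(per-pair datum with `K`, `P`, `L(W^{(d_K)},1) ≠ 0`) and generation 36's `KrizLiLocusLValueFree` (per-pair field `K`).  CONDITIONAL on the four
displayed published facts; closes nothing by name; BSD is NOT advanced. [cite: KrizLi2019, Thm. 9.4, Rem. 9.6, §8, Thm. 1.20]
[cite: JetchevSkinnerWan2017, §7.4.1 (arXiv:1512.06894 p. 30)] -/
theorem additiveX3RankOneLower_three_onKrizLiSubLocus (hF : PrintedFacts)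
    (hKL : KrizLi2019.thm120_padicLogHeegner_unit_of_bernoulli)
    (h94 : KrizLi2019.thm94_exists_heegnerField_h3_of_threeIsogeny) (h83 : KrizLi2019.cor83_bernoulli_unit_three_of_h3) :
    ∀ (W : WeierstrassCurve ℚ) [W.IsElliptic] [W.IsGloballyMinimal],
      W.analyticRank = 1 → ClassX3 W 3 → Additive.SubSemistableTwist W 3 →
      (∃ (f : ℕ) (_ : NeZero f) (ψ : DirichletCharacter ℚ_[3] f) (ω : DirichletCharacter ℚ_[3] 3),
        ψ.IsPrimitive ∧ ψ ^ 2 = 1 ∧ KrizLi2019.IsTeichmullerCharacter ω ∧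
        (∀ q : ℕ, q.Prime → q ∣ f → q ∣ 3 * W.conductorNorm ℤ) ∧
        (∀ ℓ : ℕ, ℓ.Prime → ¬ (ℓ ∣ 3 * W.conductorNorm ℤ) →
          ‖((W.LFunction ℓ : ℤ) : ℚ_[3]) - (ψ (ℓ : ZMod f) + ψ⁻¹ (ℓ : ZMod f) * ω (ℓ : ZMod 3))‖ < 1) ∧
        ψ ((3 : ℕ) : ZMod f) ≠ 1 ∧ KrizLi2019.primVal (KrizLi2019.invMulOmega ψ ω) 3 ≠ 1 ∧
        (∀ ℓ : ℕ, (hℓ : ℓ.Prime) → ¬ (haveI := Fact.mk hℓ; W.HasSplitMultiplicativeReductionAtPrime ℓ)) ∧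
        (∀ ℓ : ℕ, (hℓ : ℓ.Prime) → ℓ ≠ 3 →
          (haveI := Fact.mk hℓ; ¬ W.HasGoodReductionAtPrime ℓ ∧ ¬ W.HasMultiplicativeReductionAtPrime ℓ) →
          ψ (ℓ : ZMod f) ≠ 1 ∧ KrizLi2019.primVal (KrizLi2019.invMulOmega ψ ω) ℓ ≠ 1) ∧
        (∀ ℓ : ℕ, (hℓ : ℓ.Prime) → ℓ ≠ 3 →
          (haveI := Fact.mk hℓ; W.HasMultiplicativeReductionAtPrime ℓ ∧ ¬ W.HasSplitMultiplicativeReductionAtPrime ℓ) →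
          ψ (ℓ : ZMod f) = 1) ∧
        (∀ ℓ : ℕ, (hℓ : ℓ.Prime) → ℓ % 3 = 1 →
          (haveI := Fact.mk hℓ; ¬ W.HasGoodReductionAtPrime ℓ ∧ ¬ W.HasMultiplicativeReductionAtPrime ℓ) →
          ψ (ℓ : ZMod f) = -1 ∨ ψ (ℓ : ZMod f) = 0) ∧
        (∀ ℓ : ℕ, (hℓ : ℓ.Prime) → ℓ % 3 = 2 →
          (haveI := Fact.mk hℓ; ¬ W.HasGoodReductionAtPrime ℓ ∧ ¬ W.HasMultiplicativeReductionAtPrime ℓ) →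
          ψ (ℓ : ZMod f) = 0) ∧
        (ψ.Even → ThreeClassNumberTrivial (-3 * (f : ℤ))) ∧ (ψ.Odd → ThreeClassNumberTrivial (-(f : ℤ)))) →
      MissingLowerBoundAt W 3 := by
  intro W _ _ hr hX hS hdat
  obtain ⟨f, _, ψ, ω, hψ, hq, hω, hfN, hss, h1, h1', h2, h3, h94c, h94d, h94e, h6e, h6o⟩ := hdat
  exact missingLowerBoundAt_three_of_printedFacts_of_krizLi_of_thm94 hF hKL h94 h83 W hr hX hS f ψ ω hψ hq hω hfN hss h1 h1' h2 h3
    h94c h94d h94e ⟨h6e, h6o⟩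

end Summit.BirchSwinnertonDyer.BirchSwinnertonDyer.Theorems.SchneiderFreeAdditiveX3.KrizLiLocusSupplyThree

end
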